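import Summits.QuantumFields.YangMills.Theorems.BalabanUVNodesPortZDStepUnitSel

/-!
# K0⁷ — THE RECORD-SIDE FORMAT NAMES, EDITION 34 = THE (β1) NAMES EDITION: `recordTermsAxSel` ∕ `recordΦfAxSel` — the record's merged-term family and charted functional READ THROUGH THE ROOTED
# (0.21) SELECTOR `UkSel` (◆ CRIT-1 g40 (N-0) CRITIC LINE nodeO STATUS 2026-08-31 l.6076: the (N-0) door is a SELECTOR MISMATCH; ★★★ №628 (5)∕№629 (β1) road ADOPTED; ▶ PTC-1 g5 INTENT-93′
# ✓`…PortZDStepUnitSel` l.6083: «the one-token NAMES EDITION this prepares … DEF-1's pen»)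

Cell `ym-nodeO-ideate` ∕ `ym-balaban-port`, DEFINER seat `ym-nodeO-def-1` (gen 39); `--kind definition --supports stmt-QuantumFields-20541 --as helper`; count-neutral.
[I] = [Balaban1987RG1].

WHY.  `recordΦfAx … 0 = 0` («the normalization constant is the integral at U_{k+1} = 1», (2.12)) is EQUIVALENT to the bare-`Uk` door `hinv : A_k(Ū^k(Uk_{k+1}(1))) = A_k(1)`
(▶ PTC-1's ✓`recordΦfAx_apply_zero_iff`) because ✓`recordTermsAx` (ed. Ax :58) reads lit's `mergedTermFamilyMatT`, typed with the BARE choice `Node00.Uk`, while the chart's background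
✓`recordBgField` reads the ROOTED `UkSel`.  ◆'s kernel line `iter_UkSel_succ_one`: through the chart's OWN selector the normalisation point IS `1`.  ▶ PTC-1's ✓`…PortZDStepUnitSel` types the
one-step rows with the selector DISPLAYED (`mergedTermFamilyMatWithT sel`, `= mergedTermFamilyMatT` at `sel := Uk` by `rfl`) and proves ★★`ΦfOf_mergedTermFamilyMatWithT_UkSel_apply_zero`.
THIS FILE is the names edition it prepares.  APPEND-ONLY RULE (gate `theorems.append-only`; this lineage's ED.24 → `…G`∕`…GL` precedent): the landed bodies of `recordTermsAx`∕`recordΦfAx` are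
NOT mutated — the rooted readings are NEW names; consumers (▶ PTC-1's census (a): ✓`…PortS1Functional`, ✓`…PortS1RecordPhiAxZero`, ✓`…PortS1FENormalisationZero`, ✓`…PortS1SplitGerm`;
hand-FE's `FEStepBox`∕`FEStepReg` letters) RE-KEY `recordΦfAx ↦ recordΦfAxSel` in THEIR next editions; the 59 abstract readers of `recordTermsAx` are untouched.

WHAT THIS FILE IS (two definitions + faces; NEW names):
* ★ `recordTermsAxSel F a₀ ε₂₉ := mergedTermFamilyMatWithT F 2 (UkSel F 2) (TβOfRecord₁₃ F 2) (chiβOfRecord₁₃Ax F 2 θfill) θfill.εbg` — ▶ PTC-1's formula VERBATIM (ed. Ax :58 with the ONE token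
  `mergedTermFamilyMatT ↦ mergedTermFamilyMatWithT … (UkSel F 2)`); face `recordTermsAx_eq_WithT_Uk` (the LANDED family IS the displayed-selector family at `sel := Uk`, `rfl` via
  ✓`mergedTermFamilyMatWithT_Uk`) — so the edition changes EXACTLY the selector token and nothing else.
* ★ `recordΦfAxSel F a₀ ε₂₉ k v K := ΦfOf F (recordTermsAxSel …) θ.ρ8 k v K` (ed. Ax :68 with the one token); faces `recordΦfAxSel_eq_mergedTermWithT_unitField` (`rfl`, the twin of
  ✓`recordΦfAx_eq_mergedTermT_unitField`) and ★★ `recordΦfAxSel_apply_zero (hk : k + 1 ≤ m + K) : recordΦfAxSel … K 0 = 0` — UNCONDITIONAL at every `k` (▶ PTC-1's ★★ BY NAME).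
NO equality `recordΦfAxSel = recordΦfAx` is claimed (that IS (β2)'s pointwise-invariance problem, ◆ l.6076); the bare-`Uk` door is RELOCATED to the selector token, not discharged.

HONEST FRAMING.  Definitions + bookkeeping faces; NOTHING of Bałaban's (1.4)–(1.7)∕(2.12)∕§2–§5 is asserted, ported or discharged; `stub_FEstepReg`∕`stub_P0C`∕`stub_LZhalfReg` OPEN, ⟨27930⟩ OPEN;
K0⁷ ∕ K0ᴬ ∕ K1ᴬ ∕ K3ᴬ OPEN; NODE O 0∕1; COUNT 8∕28 · K 1∕4 UNMOVED; finite `𝕋⁴_{L^K}` at fixed ε — NOT continuum ∕ ℝ⁴ ∕ OS; **the Yang–Mills mass gap (Clay) is NOT proved by any of this.**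
No `sorry`, `instance`, `notation`; standard axioms.
-/

noncomputable section

open scoped BigOperators Matrix.Norms.L2Operator

namespace Summit.QuantumFields.YangMills.Theorems.K0RecordFormatNames

open Literature.MathematicalPhysics.QuantumFieldTheory.Balaban1983to89
open Literature.MathematicalPhysics.QuantumFieldTheory.Balaban1983to89.Node00
open Literature.MathematicalPhysics.QuantumFieldTheory.Balaban1983to89.T4Continuum (T4Family)
open Literature.MathematicalPhysics.QuantumFieldTheory.Balaban1983to89.T4FlagMemory (extd)
open Summit.QuantumFields.YangMills.Theorems.PortZD (mergedTermFamilyMatWithT mergedTermWithT mergedTermFamilyMatWithT_Uk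
  ΦfOf_mergedTermFamilyMatWithT_eq ΦfOf_mergedTermFamilyMatWithT_UkSel_apply_zero)

variable (F : T4Family)

/-! ## §24t  The rooted readings -/

/-- ★ **THE RECORD's MERGED-TERM FAMILY THROUGH THE ROOTED SELECTOR**: `recordTermsAxSel F a₀ ε₂₉ := mergedTermFamilyMatWithT F 2 (UkSel F 2) (TβOfRecord₁₃ F 2) (chiβOfRecord₁₃Ax F 2 θfill) θfill.εbg`
— ed. Ax's ✓`recordTermsAx` with the ONE token `mergedTermFamilyMatT ↦ mergedTermFamilyMatWithT … (UkSel F 2)` (▶ PTC-1's formula verbatim): the normalisation background `Ū^k(U_{k+1}(W))`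
of (1.6) is read through the SAME rooted (0.21) selector as the chart's ✓`recordBgField`. [cite: Balaban1987RG1, (1.6) p.261, (0.21) p.256, (2.3) p.265, (2.12) p.268] -/
def recordTermsAxSel (a₀ ε₂₉ : ℝ) : TermFamily1 F (MatA 2) :=
  mergedTermFamilyMatWithT F 2 (UkSel F 2) (TβOfRecord₁₃ F 2) (chiβOfRecord₁₃Ax F 2 (thetaFill F a₀ ε₂₉)) (thetaFill F a₀ ε₂₉).εbg

/-- FACE (`rfl`): the LANDED family ✓`recordTermsAx` IS the displayed-selector family at the BARE choice `sel := Uk` — so this edition changes exactly the selector token. [cite: Balaban1987RG1, (1.6) p.261 (bookkeeping)] -/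
theorem recordTermsAx_eq_WithT_Uk (a₀ ε₂₉ : ℝ) :
    recordTermsAx F a₀ ε₂₉ = mergedTermFamilyMatWithT F 2 (Uk F 2) (TβOfRecord₁₃ F 2) (chiβOfRecord₁₃Ax F 2 (thetaFill F a₀ ε₂₉)) (thetaFill F a₀ ε₂₉).εbg := by
  rw [mergedTermFamilyMatWithT_Uk]
  rfl

/-- ★ **THE CHARTED FUNCTIONAL THROUGH THE ROOTED SELECTOR**: `recordΦfAxSel F a₀ ε₂₉ k v K := ΦfOf F (recordTermsAxSel …) θ.ρ8 k v K` — ed. Ax's ✓`recordΦfAx` with the one token.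
[cite: Balaban1987RG1, (1.6) p.261, (1.20) p.264, (2.9) p.266] -/
def recordΦfAxSel (a₀ ε₂₉ : ℝ) (k : ℕ) (v : Fin (k + 1) → ℝ) (K : ℕ) : recordW F a₀ ε₂₉ k K → ℂ :=
  letI θ := thetaFill F a₀ ε₂₉
  letI := θ.instVβ₁; letI := θ.instVβ₂
  ΦfOf F (recordTermsAxSel F a₀ ε₂₉) θ.ρ8 k v K

/-- FACE (`rfl`, the twin of ✓`recordΦfAx_eq_mergedTermT_unitField`): the rooted functional IS `𝓝^{UkSel}_{k+1}(extd v; W_B)`, complexified. [cite: Balaban1987RG1, (1.6) p.261, (2.3) p.265 (bookkeeping)] -/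
theorem recordΦfAxSel_eq_mergedTermWithT_unitField (a₀ ε₂₉ : ℝ) (k : ℕ) (v : Fin (k + 1) → ℝ) (K : ℕ) (B : recordW F a₀ ε₂₉ k K) :
    letI θ := thetaFill F a₀ ε₂₉
    letI := θ.instVβ₁; letI := θ.instVβ₂
    recordΦfAxSel F a₀ ε₂₉ k v K B =
      ((mergedTermWithT F 2 (UkSel F 2) (TβOfRecord₁₃ F 2) (chiβOfRecord₁₃Ax F 2 θ) θ.εbg K (extd v) k (unitField F θ k K B) : ℝ) : ℂ) :=
  ΦfOf_mergedTermFamilyMatWithT_eq F (UkSel F 2) a₀ ε₂₉ k v K B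

/-- ★★ **`recordΦfAxSel … 0 = 0` AT EVERY `k`, UNCONDITIONALLY** («the normalization constant … is the integral at U_{k+1} = 1», (2.12)) — ▶ PTC-1's ★★`ΦfOf_mergedTermFamilyMatWithT_UkSel_apply_zero`
BY NAME (◆'s `iter_UkSel_succ_one`: through the rooted selector the normalisation point is `1`). No `hinv`, no N09 rows. [cite: Balaban1987RG1, (2.12) p.268, (1.6) p.261, (2.3) p.265] -/
theorem recordΦfAxSel_apply_zero (a₀ ε₂₉ : ℝ) (k : ℕ) (v : Fin (k + 1) → ℝ) (K : ℕ) (hk : k + 1 ≤ (F.P K).m + (F.P K).K) :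
    letI θ := thetaFill F a₀ ε₂₉
    letI := θ.instVβ₁; letI := θ.instVβ₂
    recordΦfAxSel F a₀ ε₂₉ k v K 0 = 0 :=
  ΦfOf_mergedTermFamilyMatWithT_UkSel_apply_zero F a₀ ε₂₉ k v K hk

end Summit.QuantumFields.YangMills.Theorems.K0RecordFormatNames

end
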